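import Summits.ValiantsHypothesis.ValiantsHypothesis.Theorems.BarrierLeverChowBenchmarkPairsBlockPeelCert724
import Summits.ValiantsHypothesis.ValiantsHypothesis.Theorems.BarrierLeverChowBenchmarkPairsBlockPeelCertR724x2
import Summits.ValiantsHypothesis.ValiantsHypothesis.Theorems.BarrierLeverChowBenchmarkPairsBlockPeelCertR724x3
import Summits.ValiantsHypothesis.ValiantsHypothesis.Theorems.BarrierLeverChowBenchmarkPairsBlockPeelCertB892
import Summits.ValiantsHypothesis.ValiantsHypothesis.Theorems.BarrierLeverChowBenchmarkPairsBlockPeelCertB959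
import Summits.ValiantsHypothesis.ValiantsHypothesis.Theorems.BarrierLeverChowBenchmarkPairsBlockPeelCertB1149
import Summits.ValiantsHypothesis.ValiantsHypothesis.Theorems.BarrierLeverChowBenchmarkPairsBlockPeelCertBS364
import Summits.ValiantsHypothesis.ValiantsHypothesis.Theorems.BarrierLeverChowBenchmarkPairsBlockPeelCertBS573
import Summits.ValiantsHypothesis.ValiantsHypothesis.Theorems.BarrierLeverChowBenchmarkPairsBlockPeelCertBS628
import Summits.ValiantsHypothesis.ValiantsHypothesis.Theorems.BarrierLeverChowBenchmarkPairsBlockPeelCertBS444x3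
import Summits.ValiantsHypothesis.ValiantsHypothesis.Theorems.BarrierLeverChowBenchmarkPairsBlockPeelCertBS725
import Summits.ValiantsHypothesis.ValiantsHypothesis.Theorems.BarrierLeverChowBenchmarkPairsBlockPeelCertBS726x3
import Summits.ValiantsHypothesis.ValiantsHypothesis.Theorems.BarrierLeverChowBenchmarkPairsBlockPeelCertBS892x3
import Summits.ValiantsHypothesis.ValiantsHypothesis.Theorems.BarrierLeverChowBenchmarkPairsBlockPeelCertBS959
import Summits.ValiantsHypothesis.ValiantsHypothesis.Theorems.BarrierLeverChowBenchmarkPairsBlockPeelCertBS1149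

/-!
# Route BarrierLever — item 22038 `ChowBenchmarkPairs`, line `moore-peel`: CONJECTURE B3 BY NAME for EVERY `1 ≤ i ≤ 1457`
# (kernel ⊕ computational lane, `Lean.ofReduceBool`)

Helper file, **computational (inherited from the block certificates)** (`--computational --supports stmt-ValiantsHypothesis-22038`; cell
valiant-natproofs, rung V4, 𝒟-side benchmark of record, line `moore_peel`; seat val-np-p4 gen 30).  Closes NO item; definition-free.

`Stmt.conjB3` (`…BlockPeelTriples`) says every triple block `J^{!}(i,3)` has nonzero symbolic determinant.  By CONCATENATION
(`…BlockPeelConcat`, p715288) a triple over good stages of THEOREM W is good (`…BlockPeelConcatTable`); the triples touching one of the ten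
bad stages `≤ 1459` (`183, 364, 444, 573, 628, 725, 726, 892, 959, 1149`) are certified through sub-blocks: single ⊕ preceding double,
double ⊕ single, or — where the bad-start double is itself singular (`{444,445}`, `{726,727}`, `{892,893}`) or the run demands it
(`{724,725,726}`) — a direct 3-block certificate.  All certificates are DATA-FREE `native_decide` LU checks (kits `…CertLU/LUP/Pack/PackFast`).

* `conjB3_instance_of_le_1457 : ∀ i, 1 ≤ i → i ≤ 1457 → det J^{!}(i,3)(Λ) ≠ 0`.

WHAT THIS IS NOT: `Stmt.conjB3` (∀ i) is OPEN; nothing on crux stmt-ValiantsHypothesis-14610 or on `VP` versus `VNP`.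
-/

set_option linter.dupNamespace false

namespace Summit.ValiantsHypothesis.ValiantsHypothesis.Theorems.BarrierLever.MoorePeel

/-- THEOREM W's table: the triples inside `[1, 1460)` touching a bad stage. -/
theorem near_bad_le_1457 : ∀ i ∈ List.range 1458, 1 ≤ i →
    (i ∈ badStagesLe5000 ∨ i + 1 ∈ badStagesLe5000 ∨ i + 2 ∈ badStagesLe5000) →
    i ∈ [181, 182, 183, 362, 363, 364, 442, 443, 444, 571, 572, 573, 626, 627, 628, 723, 724, 725, 726, 890, 891, 892, 957, 958, 959, 1147, 1148, 1149] := by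
  decide +kernel

/-- **CONJECTURE B3 BY NAME for EVERY `1 ≤ i ≤ 1457`**: `det J^{!}(i,3)(Λ_0,Λ_1,Λ_2) ≠ 0` in `ℤ[Λ]` (kernel away from the bad stages,
computational at the 28 triples touching them). -/
theorem conjB3_instance_of_le_1457 (i : ℕ) (hi : 1 ≤ i) (hi' : i ≤ 1457) :
    (blockMatrix Nat.factorial i 3 (fun s : Fin 3 => (MvPolynomial.X s : MvPolynomial (Fin 3) ℤ))).det ≠ 0 := by
  by_cases hnear : i ∈ badStagesLe5000 ∨ i + 1 ∈ badStagesLe5000 ∨ i + 2 ∈ badStagesLe5000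
  · have hmem := near_bad_le_1457 i (List.mem_range.mpr (by omega)) hi hnear
    simp only [List.mem_cons, List.not_mem_nil, or_false] at hmem
    rcases hmem with rfl | rfl | rfl | rfl | rfl | rfl | rfl | rfl | rfl | rfl | rfl | rfl | rfl | rfl | rfl | rfl | rfl | rfl | rfl | rfl | rfl | rfl | rfl | rfl | rfl | rfl | rfl | rfl
    · exact det_blockMatrix_three_ne_zero_of_single_double Nat.factorial (fun k => Nat.factorial_ne_zero k) 181 (by norm_num)
        (det_kpeelMatrix_factorial_ne_zero_of_not_mem 181 (by norm_num) (by norm_num) (by decide)) det_blockMatrix_182_2_ne_zero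
    · exact det_blockMatrix_three_ne_zero_of_double_single Nat.factorial (fun k => Nat.factorial_ne_zero k) 182 (by norm_num)
        det_blockMatrix_182_2_ne_zero (det_kpeelMatrix_factorial_ne_zero_of_not_mem 184 (by norm_num) (by norm_num) (by decide))
    · exact det_blockMatrix_three_ne_zero_of_double_single Nat.factorial (fun k => Nat.factorial_ne_zero k) 183 (by norm_num)
        det_blockMatrix_183_2_ne_zero (det_kpeelMatrix_factorial_ne_zero_of_not_mem 185 (by norm_num) (by norm_num) (by decide))
    · exact det_blockMatrix_three_ne_zero_of_single_double Nat.factorial (fun k => Nat.factorial_ne_zero k) 362 (by norm_num)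
        (det_kpeelMatrix_factorial_ne_zero_of_not_mem 362 (by norm_num) (by norm_num) (by decide)) det_blockMatrix_363_2_ne_zero
    · exact det_blockMatrix_three_ne_zero_of_double_single Nat.factorial (fun k => Nat.factorial_ne_zero k) 363 (by norm_num)
        det_blockMatrix_363_2_ne_zero (det_kpeelMatrix_factorial_ne_zero_of_not_mem 365 (by norm_num) (by norm_num) (by decide))
    · exact det_blockMatrix_three_ne_zero_of_double_single Nat.factorial (fun k => Nat.factorial_ne_zero k) 364 (by norm_num)
        det_blockMatrix_364_2_ne_zero (det_kpeelMatrix_factorial_ne_zero_of_not_mem 366 (by norm_num) (by norm_num) (by decide))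
    · exact det_blockMatrix_three_ne_zero_of_single_double Nat.factorial (fun k => Nat.factorial_ne_zero k) 442 (by norm_num)
        (det_kpeelMatrix_factorial_ne_zero_of_not_mem 442 (by norm_num) (by norm_num) (by decide)) det_blockMatrix_443_2_ne_zero
    · exact det_blockMatrix_three_ne_zero_of_double_single Nat.factorial (fun k => Nat.factorial_ne_zero k) 443 (by norm_num)
        det_blockMatrix_443_2_ne_zero (det_kpeelMatrix_factorial_ne_zero_of_not_mem 445 (by norm_num) (by norm_num) (by decide))
    · exact det_blockMatrix_444_3_ne_zero
    · exact det_blockMatrix_three_ne_zero_of_single_double Nat.factorial (fun k => Nat.factorial_ne_zero k) 571 (by norm_num)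
        (det_kpeelMatrix_factorial_ne_zero_of_not_mem 571 (by norm_num) (by norm_num) (by decide)) det_blockMatrix_572_2_ne_zero
    · exact det_blockMatrix_three_ne_zero_of_double_single Nat.factorial (fun k => Nat.factorial_ne_zero k) 572 (by norm_num)
        det_blockMatrix_572_2_ne_zero (det_kpeelMatrix_factorial_ne_zero_of_not_mem 574 (by norm_num) (by norm_num) (by decide))
    · exact det_blockMatrix_three_ne_zero_of_double_single Nat.factorial (fun k => Nat.factorial_ne_zero k) 573 (by norm_num)
        det_blockMatrix_573_2_ne_zero (det_kpeelMatrix_factorial_ne_zero_of_not_mem 575 (by norm_num) (by norm_num) (by decide))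
    · exact det_blockMatrix_three_ne_zero_of_single_double Nat.factorial (fun k => Nat.factorial_ne_zero k) 626 (by norm_num)
        (det_kpeelMatrix_factorial_ne_zero_of_not_mem 626 (by norm_num) (by norm_num) (by decide)) det_blockMatrix_627_2_ne_zero
    · exact det_blockMatrix_three_ne_zero_of_double_single Nat.factorial (fun k => Nat.factorial_ne_zero k) 627 (by norm_num)
        det_blockMatrix_627_2_ne_zero (det_kpeelMatrix_factorial_ne_zero_of_not_mem 629 (by norm_num) (by norm_num) (by decide))
    · exact det_blockMatrix_three_ne_zero_of_double_single Nat.factorial (fun k => Nat.factorial_ne_zero k) 628 (by norm_num)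
        det_blockMatrix_628_2_ne_zero (det_kpeelMatrix_factorial_ne_zero_of_not_mem 630 (by norm_num) (by norm_num) (by decide))
    · exact det_blockMatrix_three_ne_zero_of_single_double Nat.factorial (fun k => Nat.factorial_ne_zero k) 723 (by norm_num)
        (det_kpeelMatrix_factorial_ne_zero_of_not_mem 723 (by norm_num) (by norm_num) (by decide)) det_blockMatrix_724_2_ne_zero
    · exact det_blockMatrix_724_3_ne_zero
    · exact det_blockMatrix_three_ne_zero_of_double_single Nat.factorial (fun k => Nat.factorial_ne_zero k) 725 (by norm_num)
        det_blockMatrix_725_2_ne_zero (det_kpeelMatrix_factorial_ne_zero_of_not_mem 727 (by norm_num) (by norm_num) (by decide))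
    · exact det_blockMatrix_726_3_ne_zero
    · exact det_blockMatrix_three_ne_zero_of_single_double Nat.factorial (fun k => Nat.factorial_ne_zero k) 890 (by norm_num)
        (det_kpeelMatrix_factorial_ne_zero_of_not_mem 890 (by norm_num) (by norm_num) (by decide)) det_blockMatrix_891_2_ne_zero
    · exact det_blockMatrix_three_ne_zero_of_double_single Nat.factorial (fun k => Nat.factorial_ne_zero k) 891 (by norm_num)
        det_blockMatrix_891_2_ne_zero (det_kpeelMatrix_factorial_ne_zero_of_not_mem 893 (by norm_num) (by norm_num) (by decide))
    · exact det_blockMatrix_892_3_ne_zero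
    · exact det_blockMatrix_three_ne_zero_of_single_double Nat.factorial (fun k => Nat.factorial_ne_zero k) 957 (by norm_num)
        (det_kpeelMatrix_factorial_ne_zero_of_not_mem 957 (by norm_num) (by norm_num) (by decide)) det_blockMatrix_958_2_ne_zero
    · exact det_blockMatrix_three_ne_zero_of_double_single Nat.factorial (fun k => Nat.factorial_ne_zero k) 958 (by norm_num)
        det_blockMatrix_958_2_ne_zero (det_kpeelMatrix_factorial_ne_zero_of_not_mem 960 (by norm_num) (by norm_num) (by decide))
    · exact det_blockMatrix_three_ne_zero_of_double_single Nat.factorial (fun k => Nat.factorial_ne_zero k) 959 (by norm_num)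
        det_blockMatrix_959_2_ne_zero (det_kpeelMatrix_factorial_ne_zero_of_not_mem 961 (by norm_num) (by norm_num) (by decide))
    · exact det_blockMatrix_three_ne_zero_of_single_double Nat.factorial (fun k => Nat.factorial_ne_zero k) 1147 (by norm_num)
        (det_kpeelMatrix_factorial_ne_zero_of_not_mem 1147 (by norm_num) (by norm_num) (by decide)) det_blockMatrix_1148_2_ne_zero
    · exact det_blockMatrix_three_ne_zero_of_double_single Nat.factorial (fun k => Nat.factorial_ne_zero k) 1148 (by norm_num)
        det_blockMatrix_1148_2_ne_zero (det_kpeelMatrix_factorial_ne_zero_of_not_mem 1150 (by norm_num) (by norm_num) (by decide))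
    · exact det_blockMatrix_three_ne_zero_of_double_single Nat.factorial (fun k => Nat.factorial_ne_zero k) 1149 (by norm_num)
        det_blockMatrix_1149_2_ne_zero (det_kpeelMatrix_factorial_ne_zero_of_not_mem 1151 (by norm_num) (by norm_num) (by decide))
  · push Not at hnear
    obtain ⟨h0, h1, h2⟩ := hnear
    exact det_blockMatrix_factorial_X_ne_zero_of_not_mem_table i 3 hi (by omega) fun q hq => by
      interval_cases q
      · simpa using h0
      · exact h1
      · exact h2

end Summit.ValiantsHypothesis.ValiantsHypothesis.Theorems.BarrierLever.MoorePeel
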